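import Summits.HodgeConjecture.HodgeConjecture.Theorems.R90S6TorusFixedSpecialCountUnipotent        -- ★ G1 RUNG 1 (p863947) `natCard_fixedBy_special_eq_one_add_mul_of_residually_unipotent`
import Summits.HodgeConjecture.HodgeConjecture.Theorems.R90S6LevelOneCountCayleyDictionary         -- ★ G1 RUNG 2 (A) (p864111∕p864214) (R2.b) `natCard_levelOne_eq_natCard_fixedBy_of_mem_adjoin`
import Summits.HodgeConjecture.HodgeConjecture.Theorems.R90S6TypeTwoCayleyShiftOdd                -- ★∕pending B2-odd (this seat) (R2.c)-odd `exists_cayleyShift_of_typeTwo_odd`, (R2.d)-odd `norm_eq_one_and_charpoly_congr_of_typeTwo_odd`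
import Summits.HodgeConjecture.HodgeConjecture.Theorems.R90S6TorusFixedHyperspecialCountTypeTwoOdd  -- ★ FILE A (p864978) a₀^odd = phiTHprimen `natCard_fixedPoints_unitaryInt_eq_phiTHprimen_of_eigen_odd`
import HarnessLib

/-!
# R90 · S6 — LINE G1 «geometric fixed subtree», RUNG 2 ODD EDITION, FILE C: THE CLOSED FORM OF THE FIXED SPECIAL COUNT OF A TYPE-(2) ELEMENT WITH ODD EIGENLINE —
# `a₁(γ) + phiTHprimen q (n−2) (N−1) = 1 + S · phiTHprimen q (n−2) (N−1)` (`Theorems/R90S6TorusFixedSpecialCountTypeTwoOdd.lean`)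

Cell `hodgecm-mathlib`, crux H413 (`stmt-HodgeConjecture-24833`), route of record `HCCMUnconditional`; programme R90-TF, section S6 (base `R90-C14`), seat R90-C14-p07 (g2,
heir of g0); S6 dealer R90-C14-plan (g2) CARD (G2-ODD) «G1 RUNG 2 ODD EDITION» (2026-09-05T02:52:41Z; census 02:56:51Z «=», GO 02:58:02Z): FILE C = the card's target, the
ODD twin of ★ (C) `natCard_fixedBy_special_add_phiTHn_eq_of_typeTwo` (`Theorems/R90S6TorusFixedSpecialCountClosedForm.lean`, p864430) — ★ rung 1's binders and ★ FILE A's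
frame `(hσO, q, hq, hq1, a₀, ha₀)` VERBATIM, `hx : v (B₀ σ 3 x x) = exp (2k+1)` ODD; of ★ (C)'s even frame the letters `y, cW, um, R, ι, σR, dR, ϖR, hqR` are not needed by the
odd road and are dropped (★ FILE A needs none of them).  Helper lane `--supports stmt-HodgeConjecture-24833 --as helper`; ONE theorem (no definition, no instance, no notation,
no named fact, no `sorry`); imports = ★ rung 1 + ★ (A) + B2-odd + ★ FILE A + HarnessLib (no Lines import).

THE MATHEMATICS [Kottwitz1986BaseChangeUnits, §1 pp. 240–241; Kottwitz1988, §2; Flicker1998UnitaryFL, Prop. 11 p. 87, Prop. 17 p. 97, Theorem 18 p. 97; Rogawski1990, §4.9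
Prop. 4.9.1 (b) p. 55].  `K` non-dyadic valued, complete, residue field of order `q²`, `U = U(σ, J₀)(K)`, `K₀ = U ∩ GL₃(𝒪)` (root `L₀`), `K₁` the stabiliser of the special
neighbour `N₁`, `S = #star(L₀)`.  For a TYPE-(2) `γ ∈ U` — anisotropic eigenvector `x` (`γx = ux`) whose eigenline is ODD (`|B₀(x,x)| = |ϖ|^{2k+1}`, the `κ = −1` class), exponents
`(n, N)`, `2 ≤ n`, `1 ≤ N` — with finitely many fixed hyperspecial ∕ special vertices: **`a₁(γ) + phiTHprimen q (n−2) (N−1) = 1 + S · phiTHprimen q (n−2) (N−1)`**,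
`a₁ = #Fix_γ(U ⧸ K₁)`.  PROOF = the G1 ladder, odd edition: (R2.d)-odd `σu·u = 1`, `|u| = 1`, `χ_γ ≡ (X − u)³` ⟹ ★ RUNG 1 (`c := u`): `a₁ + ℓ₁ = 1 + S·ℓ₁`; (R2.c)-odd the Cayley
shift `Y = φ_ϖ(u⁻¹γ) ∈ U` (`Yx = x`, exponents `(n−2, N−1)`, `Y, Y⁻¹ ∈ 𝒪[X]`, `X ∈ 𝒪[Y]`); ★ (A) = (R2.b): `ℓ₁ = #Fix_Y(U ⧸ K₀)`; ★ FILE A at `(t, u, N, n) := (Y, 1, N−1, n−2)`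
(same ODD eigenline `x`): `#Fix_Y(U ⧸ U(𝒪)) = phiTHprimen q (n−2) (N−1)` (`U(𝒪) = K₀` by ★ `unitaryInt_eq_glInt_subgroupOf`); cast the rung-1 identity to `ℚ`.
HONEST LABEL: a composition (★ rung 1 ∘ (R2.d)-odd ∘ (R2.c)-odd ∘ ★ (A) ∘ ★ FILE A), unconditional in its own letters; count-neutral until the E1.3.5.2 (E2) assembly reads it at
the pins (`S = q_v³ + 1`); proves no printed statement.  HC_CM is proved only modulo the 7 printed citations (2 remaining named inputs: hLiu418 = stmt-HodgeConjecture-24832,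
h413 = stmt-HodgeConjecture-24833) until rung 0 closes.

## References
* [Kottwitz1986BaseChangeUnits] R. E. Kottwitz, *Base change for unit elements of Hecke algebras*, Compositio Math. 60 (1986) 237–250, §1 pp. 240–241.
* [Kottwitz1988] R. E. Kottwitz, *Tamagawa numbers*, Ann. of Math. 127 (1988), §2.
* [Flicker1998UnitaryFL] Y. Z. Flicker, *Elementary proof of the fundamental lemma for a unitary group*, Canad. J. Math. 50 (1998), Prop. 11 p. 87; Prop. 17 p. 97;
  Theorem 18 p. 97.
* [Rogawski1990] J. D. Rogawski, *Automorphic Representations of Unitary Groups in Three Variables*, Ann. of Math. Stud. 123 (1990), §4.9 Prop. 4.9.1 (b) p. 55.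
-/
set_option autoImplicit false
-- the mandated namespace repeats the single-problem summit's segment (`HodgeConjecture.HodgeConjecture`)
set_option linter.dupNamespace false

noncomputable section

open MulAction Polynomial
open Literature.NumberTheory.Automorphic Literature.NumberTheory.Automorphic.HermitianLattice Literature.NumberTheory.Automorphic.UnitaryGroup
open Literature.NumberTheory.Automorphic.UnitaryLatticeTree
open Literature.NumberTheory.Rogawski1990.Flicker1998 (phiTHprimen)
open scoped Matrix MatrixGroups WithZero

namespace Summit.HodgeConjecture.HodgeConjecture.R90.S6

open IsLocalRing in
set_option synthInstance.maxHeartbeats 400000 in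
set_option maxHeartbeats 1600000 in
-- the subgroup-quotient carriers `U ⧸ K₀`, `U ⧸ K₁` of ★ FILE 1 are slow to elaborate (same budgets as ★ rung 1 ∕ ★ (A) ∕ ★ (C))
/-- **G1 RUNG 2 (R2), ODD EDITION — THE CLOSED FORM: `a₁(γ) + phiTHprimen q (n−2) (N−1) = 1 + S · phiTHprimen q (n−2) (N−1)`** for a type-(2) `γ ∈ U(σ, J₀)(K)`
(anisotropic eigenvector `x`, `γx = ux`, `|B₀(x,x)| = |ϖ|^{2k+1}` ODD — the `κ = −1` class; exponents `(n, N)` in ★ a₀'s letters, `2 ≤ n`, `1 ≤ N`), in the letters of ★ FILE 1 ∕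
★ rung 1 (`a₁ = #Fix_γ(U ⧸ K₁)`, `S = #star(L₀)`, section `r`, the four finiteness binders) and over ★ FILE A's frame `(hσO, q, a₀)`.  Composition (R2.d)-odd → ★ RUNG 1 (`c := u`)
→ (R2.c)-odd → ★ (A) (R2.b) → ★ FILE A at the Cayley shift `Y` (eigenvalue `1`, exponents `(n−2, N−1)`, same odd eigenline), `U(𝒪) = K₀` by ★ `unitaryInt_eq_glInt_subgroupOf`.
[cite: Kottwitz1986BaseChangeUnits, §1 pp. 240–241] [cite: Kottwitz1988, §2] [cite: Flicker1998UnitaryFL, Prop. 11 p. 87; Prop. 17 p. 97; Theorem 18 p. 97]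
[cite: Rogawski1990, §4.9 Prop. 4.9.1 (b) p. 55] -/
theorem natCard_fixedBy_special_add_phiTHprimen_eq_of_typeTwo_odd {K : Type*} [Field K] [Valued K ℤᵐ⁰] [ValuativeRel K] [(Valued.v : Valuation K ℤᵐ⁰).Compatible]
    [IsDiscreteValuationRing (Valued.integer K)] [Finite (ResidueField (Valued.integer K))] [IsAdicComplete (maximalIdeal (Valued.integer K)) (Valued.integer K)]
    {σ : K →+* K} {ϖ : K} (hd : LocalConjDatum σ ϖ)
    -- ★ FILE 1 ∕ rung 1 binders
    (g₁ : GL (Fin 3) K) (hg₁ : (g₁ : Matrix (Fin 3) (Fin 3) K) = Matrix.diagonal ![(1 : K), 1, ϖ])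
    (γ : ↥(unitaryGroupOfForm σ ((StdForm.antidiagonal 3).over K)))
    [Fintype (fixedBy (↥(unitaryGroupOfForm σ ((StdForm.antidiagonal 3).over K)) ⧸
      (glInt 3 K).subgroupOf (unitaryGroupOfForm σ ((StdForm.antidiagonal 3).over K))) γ)]
    (hK₁fin : (fixedBy (↥(unitaryGroupOfForm σ ((StdForm.antidiagonal 3).over K)) ⧸
      ((glInt 3 K).map (MulAut.conj g₁).toMonoidHom).subgroupOf (unitaryGroupOfForm σ ((StdForm.antidiagonal 3).over K))) γ).Finite)
    (horb : (Set.range fun n : ℕ => ((γ ^ n : ↥(unitaryGroupOfForm σ ((StdForm.antidiagonal 3).over K))) :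
      ↥(unitaryGroupOfForm σ ((StdForm.antidiagonal 3).over K)) ⧸ (glInt 3 K).subgroupOf (unitaryGroupOfForm σ ((StdForm.antidiagonal 3).over K)))).Finite)
    (r : ↥(unitaryGroupOfForm σ ((StdForm.antidiagonal 3).over K)) ⧸ (glInt 3 K).subgroupOf (unitaryGroupOfForm σ ((StdForm.antidiagonal 3).over K)) →
      ↥(unitaryGroupOfForm σ ((StdForm.antidiagonal 3).over K)))
    (hr : Function.RightInverse r QuotientGroup.mk)
    [∀ x : fixedBy (↥(unitaryGroupOfForm σ ((StdForm.antidiagonal 3).over K)) ⧸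
        (glInt 3 K).subgroupOf (unitaryGroupOfForm σ ((StdForm.antidiagonal 3).over K))) γ,
      Finite (fixedBy (↥((glInt 3 K).subgroupOf (unitaryGroupOfForm σ ((StdForm.antidiagonal 3).over K))) ⧸
        (((glInt 3 K).subgroupOf (unitaryGroupOfForm σ ((StdForm.antidiagonal 3).over K)) ⊓
          ((glInt 3 K).map (MulAut.conj g₁).toMonoidHom).subgroupOf (unitaryGroupOfForm σ ((StdForm.antidiagonal 3).over K))).subgroupOf
          ((glInt 3 K).subgroupOf (unitaryGroupOfForm σ ((StdForm.antidiagonal 3).over K)))))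
        (⟨(r x.1)⁻¹ * γ * r x.1, inv_mul_mul_mem_of_smul_eq r hr γ x.2⟩ :
          ↥((glInt 3 K).subgroupOf (unitaryGroupOfForm σ ((StdForm.antidiagonal 3).over K)))))]
    -- ★ FILE A frame binders (VERBATIM from ★ `natCard_fixedPoints_unitaryInt_eq_phiTHprimen_of_eigen_odd`, `t ↦ γ`)
    (hσO : ∀ y : Valued.integer K, (σ.comp (Valued.integer K).subtype) y ∈ Valued.integer K)
    {q : ℕ} (hq : Nat.card (ResidueField (Valued.integer K)) = q ^ 2) (hq1 : 1 < q)
    {a₀ : Valued.integer K} (ha₀ : IsUnit (((σ.comp (Valued.integer K).subtype).codRestrict (Valued.integer K) hσO) a₀ - a₀))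
    -- the type-(2) data of `γ`: anisotropic eigenvector `x` (eigenvalue `u`) with ODD eigenline, exponents `(n, N)`
    {x : Fin 3 → K} {u : K} (hγx : (((γ : ↥(unitaryGroupOfForm σ ((StdForm.antidiagonal 3).over K))) : GL (Fin 3) K) : Matrix (Fin 3) (Fin 3) K) *ᵥ x = u • x)
    {k : ℤ} (hx : Valued.v (B₀ σ 3 x x) = WithZero.exp (2 * k + 1))
    {N n : ℕ} (hN : Valued.v ((Matrix.trace (((γ : ↥(unitaryGroupOfForm σ ((StdForm.antidiagonal 3).over K))) : GL (Fin 3) K) : Matrix (Fin 3) (Fin 3) K) - u) ^ 2 -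
      4 * (Matrix.det (((γ : ↥(unitaryGroupOfForm σ ((StdForm.antidiagonal 3).over K))) : GL (Fin 3) K) : Matrix (Fin 3) (Fin 3) K) / u)) = Valued.v (ϖ ^ (2 * N + 1)))
    (hn : Valued.v (u ^ 2 - (Matrix.trace (((γ : ↥(unitaryGroupOfForm σ ((StdForm.antidiagonal 3).over K))) : GL (Fin 3) K) : Matrix (Fin 3) (Fin 3) K) - u) * u +
      Matrix.det (((γ : ↥(unitaryGroupOfForm σ ((StdForm.antidiagonal 3).over K))) : GL (Fin 3) K) : Matrix (Fin 3) (Fin 3) K) / u) = Valued.v (ϖ ^ n))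
    (hn2 : 2 ≤ n) (hN1 : 1 ≤ N) :
    (Nat.card (fixedBy (↥(unitaryGroupOfForm σ ((StdForm.antidiagonal 3).over K)) ⧸
        ((glInt 3 K).map (MulAut.conj g₁).toMonoidHom).subgroupOf (unitaryGroupOfForm σ ((StdForm.antidiagonal 3).over K))) γ) : ℚ) +
      phiTHprimen q (n - 2) (N - 1) =
      1 + (((latticeGraph σ ϖ ((StdForm.antidiagonal 3).over K)).neighborSet ⟨stdLattice K 3, 0, isSelfDualLattice_stdLattice_three hd.toUnramified⟩).ncard : ℚ) *
        phiTHprimen q (n - 2) (N - 1) := by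
  -- (R2.d)-odd: the normalising scalar is the eigenvalue, `χ_γ ≡ (X − u)³`
  obtain ⟨hσu, hvu, hχ⟩ := norm_eq_one_and_charpoly_congr_of_typeTwo_odd hd hσO ha₀ hγx hx hN hn hn2 hN1
  -- ★ RUNG 1 at `c := u`: `a₁ + ℓ₁ = 1 + S·ℓ₁`
  have h1 := natCard_fixedBy_special_eq_one_add_mul_of_residually_unipotent hd.toUnramified g₁ hg₁ γ hK₁fin horb r hr hvu hχ
  -- (R2.c)-odd: the Cayley shift `Y`
  obtain ⟨Y, hYx, hNY, hnY, hY, hY', hX⟩ := exists_cayleyShift_of_typeTwo_odd hd hσO ha₀ hγx hx hN hn hn2 hN1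
  -- ★ (A) (R2.b): `ℓ₁ = #Fix_Y(U ⧸ K₀)`
  have huu : Valued.v (u - u) < 1 := by rw [sub_self, map_zero]; exact zero_lt_one
  have hℓ := natCard_levelOne_eq_natCard_fixedBy_of_mem_adjoin hd.vσ hd.vϖ γ r hr hvu hσu huu Y hY hY' hX
  -- ★ FILE A at `(t, u, N, n) := (Y, 1, N − 1, n − 2)`, same odd eigenline `x`
  have ha := natCard_fixedPoints_unitaryInt_eq_phiTHprimen_of_eigen_odd σ rfl hd hσO hq hq1 ha₀ hYx hx hNY hnY
  rw [unitaryInt_eq_glInt_subgroupOf] at ha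
  change (Nat.card (fixedBy (↥(unitaryGroupOfForm σ ((StdForm.antidiagonal 3).over K)) ⧸
      (glInt 3 K).subgroupOf (unitaryGroupOfForm σ ((StdForm.antidiagonal 3).over K))) Y) : ℚ) = phiTHprimen q (n - 2) (N - 1) at ha
  -- cast the rung-1 identity to `ℚ`
  rw [hℓ] at h1
  have h1' := congrArg (Nat.cast : ℕ → ℚ) h1
  simp only [Nat.cast_add, Nat.cast_mul, Nat.cast_one] at h1'
  rw [ha] at h1'
  exact h1'

end Summit.HodgeConjecture.HodgeConjecture.R90.S6

end
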